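import Summits.Ventures.CertifiedQuantumChemistry.Rows.HubbardRingTVEnergyFormula
import Summits.Ventures.CertifiedQuantumChemistry.Rows.HubbardRingTVDoubleOccupancyMonotone
import Summits.Ventures.CertifiedQuantumChemistry.Rows.HubbardRingTVDoublonBound
import Summits.Ventures.CertifiedQuantumChemistry.Rows.SpinSectors
import HarnessLib

/-!
# Ventures/CertifiedQuantumChemistry — Rows/HubbardRingTVGroundStateEnergyPerSite.lean: the RING ENERGY
# FORMULA on states — for `L ≥ 3`, `⟨ψ, H ψ⟩ = −t·Σ_x Σ_σ (⟨c†_{xσ} c_{(x+1)σ}⟩ + ⟨c†_{(x+1)σ} c_{xσ}⟩)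
# + U·Σ_x ⟨n_{x↑} n_{x↓}⟩` for EVERY vector; in the half-filled ground state of the even ring `L = 2n ≥ 4`
# the INTENSIVE IDENTITY `E₀/L = −4t·B + U·D` with ONE real bond amplitude `B` and ONE double occupancy
# `D`, hence `U·D ≤ 4t·B`, `t·B ≥ 0` and `8n·t·B ≤ −E₀(2n; t, 0; n, n)` (the free bond amplitude bounds it)

HONEST FRAMING (verbatim): certified bounds for a stated model Hamiltonian in a stated basis; not a
claim about the real molecule beyond that model.

Seat rdm-B, ROWS courtesy file (theorems only; no `def`, no notation, no instance; zero compute). The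
EXACT twin of `Rows/HubbardRingTVEnergyFormula.lean` (the functional side, same gen): there the
relaxation value per site of `hubbardRingTV L t U` is a two-number expression at a symmetric optimum;
here the exact sector energy per site is the same two-number expression in the (unique, Lieb 1989)
half-filled ground state, whose one-body and density–density expectations gen 38's
`Rows/HubbardRingTVGroundStateSymmetry.lean` proved site-, spin- and orientation-independent.

* §1 `ring_hopping_eq` — the hopping operator of the ring for `L ≥ 3`:
  `Σ_{x,y,σ} [x ~ y] c†_{xσ} c_{yσ} = Σ_x Σ_σ (c†_{xσ} c_{(x+1)σ} + c†_{(x+1)σ} c_{xσ})`;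
  **`hubbardRingTV_hamiltonian_eq_bonds_add_onsite`** — `H_F = −t·(that) + U·Σ_x n_{x↑} n_{x↓}` (the T-06
  bridge `hubbardRingTV_hamiltonian_eq`); **`hubbardRingTV_expect_eq`** — the expectation of ANY vector.
* §2 the half-filled ground state of `hubbardRingTV (2n) t U`, `n ≥ 2`, `t ≠ 0`, `U > 0`:
  **`hubbardRingTV_groundState_expect_eq_mul_site`** — `⟨ψ, H ψ⟩ = 2n·(−4t·⟨c†_{p₀σ₀} c_{(p₀+1)σ₀}⟩_ψ +
  U·⟨n_{p₀↑} n_{p₀↓}⟩_ψ)` for EVERY site `p₀` and spin `σ₀`; `hubbardRingTV_groundEnergy_eq_energy`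
  (`E₀(H; N = 2n) = E₀(H; n, n)`, the cell's K1 quantity, by the tree's `SU(2)` lemma);
  **`hubbardRingTV_energy_mul_norm_eq_mul_site`** (`E₀·‖ψ‖² = 2n·(−4t·B + U·D)`) and the real form for a
  unit ground state **`hubbardRingTV_energy_eq_mul_site`**: `E₀(2n; t, U; n, n) = 2n·(−4t·Re B + U·Re D)`.
* §3 consequences: `re_expect_doubleOccupancy_nonneg` (`0 ≤ Re⟨n_{x↑} n_{x↓}⟩` in every vector);
  `hubbardRingTV_groundState_oneBody_im` (every one-body expectation of the ground state is REAL — the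
  tree's Lieb–Loss–McCann reality lemma); **`hubbardRingTV_groundState_mul_doubleOccupancy_le`** —
  `U·Re D ≤ 4t·Re B` (from `E₀ ≤ 0`, gen 35's `hubbardRingTV_sectorGroundEnergy_le_zero`: the kinetic
  energy per site pays for the interaction energy per site); **`hubbardRingTV_groundState_mul_bond_nonneg`**
  — `0 ≤ t·Re B` (the ground-state bond amplitude has the sign of `t`).
* §4 **`hubbardRingTV_groundState_mul_bond_le_free`** — `2n·4t·Re B ≤ −E₀(2n; t, 0; n, n)·‖ψ‖²`: the
  ground state lies in the `(n, n)` sector (Lieb), so its kinetic energy `⟨ψ, H(t,0) ψ⟩ = 2n·(−4t·B)`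
  (`hubbardRingTV_groundState_expect_free_eq_mul_site`) is at least the FREE sector ground energy times
  the norm (Rayleigh–Ritz) — switching on `U` can only shrink the bond amplitude; unit form with the §3
  corollary `2n·U·Re D ≤ −E₀(2n; t, 0; n, n)` (`hubbardRingTV_groundState_mul_doubleOccupancy_le_free`).

READING: structure facts about the exact ground state of the cell's own model object; no certificate,
row, claim node or value of record depends on this file; nothing here is a certified energy. All PROVED
(0 sorry, standard axioms); no defs, no named facts. References (docstring-only): E. H. Lieb, PRL 62
(1989) 1201, Thm 2 (uniqueness — through the tree); E. H. Lieb, M. Loss, R. J. McCann, J. Math. Phys. 34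
(1993) 891 (reality / uniform density of the half-filled ground state — through the tree). Tree (REUSED):
`RingSymmetry.sum_sum_ite_ringAdj` (sibling), `hubbardRingTV_hamiltonian_eq`, `ringGraph_adj`,
`hubbardRingTV_groundState_bond_eq` / `…_bond_reverse` / `…_doubleOccupancy_eq` /
`hubbardRingTV_isGroundState_graph` (gen 38), `Model.groundEnergy_eq_energy_of_le_succ` (typer),
`StrongCouplingDoublon.hubbardRingTV_sectorGroundEnergy_le_zero` (gen 35),
`star_expect_creation_mul_annihilation_of_groundState`, `LiebTwo.numberOp_mul_numberOp_mulVec`,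
`hubbardRingTV_groundState_isInSector` (gen 38), `sectorGroundEnergy_le_of_rayleigh`.
-/

noncomputable section

namespace Summit.Ventures.CertifiedQuantumChemistry

open Matrix Finset
open Literature.MathematicalPhysics.QuantumLattice Literature.MathematicalPhysics.QuantumChemistry
open Summit.Ventures.CertifiedQuantumChemistry.Hamiltonians
open scoped ComplexOrder

namespace RingEnergy

open RingSymmetry

/-! ## §1 The operator side: `H = −t·(bonds) + U·(doublons)` and the expectation of any vector -/

section State

variable {L : ℕ}

/-- **The hopping operator of the ring, `L ≥ 3`**:
`Σ_{x,y,σ} [x ~ y] c†_{xσ} c_{yσ} = Σ_x Σ_σ (c†_{xσ} c_{(x+1)σ} + c†_{(x+1)σ} c_{xσ})`. [folklore] -/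
theorem ring_hopping_eq (hL : 3 ≤ L) :
    (∑ x : Fin L, ∑ y : Fin L, ∑ σ : Fin 2,
        if (ringGraph L).Adj x y then creation (orb x σ) * annihilation (orb y σ)
        else (0 : Matrix (Finset (Orb (Fin L))) (Finset (Orb (Fin L))) ℂ)) =
      ∑ x : Fin L, ∑ σ : Fin 2, (creation (orb x σ) * annihilation (orb (finRotate L x) σ) +
        creation (orb (finRotate L x) σ) * annihilation (orb x σ)) := by
  have h1 : ∀ x y : Fin L, (∑ σ : Fin 2,
      if (ringGraph L).Adj x y then creation (orb x σ) * annihilation (orb y σ)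
        else (0 : Matrix (Finset (Orb (Fin L))) (Finset (Orb (Fin L))) ℂ)) =
      if Hamiltonians.ringAdj L x y then ∑ σ : Fin 2, creation (orb x σ) * annihilation (orb y σ) else 0 := by
    intro x y
    simp only [ringGraph_adj]
    split_ifs <;> simp
  simp_rw [h1]
  rw [sum_sum_ite_ringAdj hL]
  exact Finset.sum_congr rfl fun x _ => by rw [← Finset.sum_add_distrib]

/-- **THE RING HAMILTONIAN AS BONDS PLUS DOUBLONS, `L ≥ 3`**:
`H_F(hubbardRingTV L t U) = −t Σ_x Σ_σ (c†_{xσ} c_{(x+1)σ} + c†_{(x+1)σ} c_{xσ}) + U Σ_x n_{x↑} n_{x↓}`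
(the T-06 bridge `hubbardRingTV_hamiltonian_eq` and `ring_hopping_eq`). [folklore] -/
theorem hubbardRingTV_hamiltonian_eq_bonds_add_onsite (hL : 3 ≤ L) (t U : ℚ) :
    (hubbardRingTV L t U).hamiltonian =
      -(t : ℂ) • ∑ x : Fin L, ∑ σ : Fin 2, (creation (orb x σ) * annihilation (orb (finRotate L x) σ) +
          creation (orb (finRotate L x) σ) * annihilation (orb x σ)) +
        (U : ℂ) • ∑ x : Fin L, numberOp x 0 * numberOp x 1 := by
  rw [hubbardRingTV_hamiltonian_eq, hamiltonian, ring_hopping_eq hL, Complex.ofReal_ratCast,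
    Complex.ofReal_ratCast]

/-- **THE ENERGY EXPECTATION OF ANY VECTOR, `L ≥ 3`**:
`⟨ψ, H ψ⟩ = −t Σ_x Σ_σ (⟨c†_{xσ} c_{(x+1)σ}⟩_ψ + ⟨c†_{(x+1)σ} c_{xσ}⟩_ψ) + U Σ_x ⟨n_{x↑} n_{x↓}⟩_ψ`.
[folklore] -/
theorem hubbardRingTV_expect_eq (hL : 3 ≤ L) (t U : ℚ) (ψ : Fock (Orb (Fin L))) :
    expect (hubbardRingTV L t U).hamiltonian ψ =
      -(t : ℂ) * ∑ x : Fin L, ∑ σ : Fin 2,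
          (expect (creation (orb x σ) * annihilation (orb (finRotate L x) σ)) ψ +
            expect (creation (orb (finRotate L x) σ) * annihilation (orb x σ)) ψ) +
        (U : ℂ) * ∑ x : Fin L, expect (numberOp x 0 * numberOp x 1) ψ := by
  rw [hubbardRingTV_hamiltonian_eq_bonds_add_onsite hL]
  simp only [Literature.MathematicalPhysics.QuantumLattice.expect, Matrix.add_mulVec, Matrix.smul_mulVec,
    Matrix.sum_mulVec, dotProduct_add, dotProduct_smul, dotProduct_sum, smul_eq_mul]

end State

/-! ## §2 The half-filled ground state of the even ring: `E₀ = L·(−4t·B + U·D)` -/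

section GroundState

variable {n : ℕ} {t U : ℚ} {ψ : Fock (Orb (Fin (2 * n)))}

/-- **THE INTENSIVE IDENTITY IN THE GROUND STATE.** On the half-filled even ring `L = 2n ≥ 4`
(`t ≠ 0`, `U > 0`) every ground state `ψ` of `hubbardRingTV (2n) t U` has, for EVERY site `p₀` and
spin `σ₀`, `⟨ψ, H ψ⟩ = 2n · (−4t·⟨c†_{p₀σ₀} c_{(p₀+1)σ₀}⟩_ψ + U·⟨n_{p₀↑} n_{p₀↓}⟩_ψ)` — one bond
amplitude `B` (site-, spin- and orientation-free, gen 38's `hubbardRingTV_groundState_bond_eq` /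
`…_bond_reverse`) and one double occupancy `D`. [folklore] -/
theorem hubbardRingTV_groundState_expect_eq_mul_site (hn : 2 ≤ n) (ht : t ≠ 0) (hU : 0 < U)
    (hψ : IsGroundState (hubbardRingTV (2 * n) t U).hamiltonian (2 * n) ψ) (p₀ : Fin (2 * n)) (σ₀ : Fin 2) :
    expect (hubbardRingTV (2 * n) t U).hamiltonian ψ =
      ((2 * n : ℕ) : ℂ) * (-(4 * (t : ℂ)) * expect (creation (orb p₀ σ₀) * annihilation (orb (finRotate (2 * n) p₀) σ₀)) ψ +
        (U : ℂ) * expect (numberOp p₀ 0 * numberOp p₀ 1) ψ) := by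
  have hn1 : 1 ≤ n := by omega
  rw [hubbardRingTV_expect_eq (by omega) t U ψ,
    Finset.sum_congr rfl fun x _ => Finset.sum_congr rfl fun σ _ => by
      rw [hubbardRingTV_groundState_bond_reverse hn1 ht hU hψ x σ,
        hubbardRingTV_groundState_bond_eq hn1 ht hU hψ x p₀ σ σ₀],
    Finset.sum_congr rfl fun x _ => hubbardRingTV_groundState_doubleOccupancy_eq hn1 ht hU hψ x p₀]
  simp only [Finset.sum_const, Finset.card_univ, Fintype.card_fin, nsmul_eq_mul]
  push_cast
  ring

/-- The ground energy of the `2n`-electron ring IS the sector quantity `E₀(H_F; n, n)` (`Model.energy`,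
the cell's K1) — the tree's `SU(2)` lemma `Model.groundEnergy_eq_energy_of_le_succ`. [folklore] -/
theorem hubbardRingTV_groundEnergy_eq_energy (n : ℕ) (t U : ℚ) :
    groundEnergy (hubbardRingTV (2 * n) t U).hamiltonian (2 * n) = Model.energy (hubbardRingTV (2 * n) t U) n n := by
  rw [show 2 * n = n + n by ring]
  exact Model.groundEnergy_eq_energy_of_le_succ (k := n + n) (hubbardRingTV_isSymmetric (n + n) t U)
    (by omega) (by omega) (by omega) (by omega)

/-- **`E₀·‖ψ‖² = 2n·(−4t·B + U·D)`**: the sector ground energy `E₀(2n; t, U; n, n)` times the norm of a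
ground state equals `2n` times the one-site expression (`L = 2n ≥ 4`, `t ≠ 0`, `U > 0`). [folklore] -/
theorem hubbardRingTV_energy_mul_norm_eq_mul_site (hn : 2 ≤ n) (ht : t ≠ 0) (hU : 0 < U)
    (hψ : IsGroundState (hubbardRingTV (2 * n) t U).hamiltonian (2 * n) ψ) (p₀ : Fin (2 * n)) (σ₀ : Fin 2) :
    ((Model.energy (hubbardRingTV (2 * n) t U) n n : ℝ) : ℂ) * (star ψ ⬝ᵥ ψ) =
      ((2 * n : ℕ) : ℂ) * (-(4 * (t : ℂ)) * expect (creation (orb p₀ σ₀) * annihilation (orb (finRotate (2 * n) p₀) σ₀)) ψ +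
        (U : ℂ) * expect (numberOp p₀ 0 * numberOp p₀ 1) ψ) := by
  rw [← hubbardRingTV_groundState_expect_eq_mul_site hn ht hU hψ p₀ σ₀,
    Literature.MathematicalPhysics.QuantumLattice.expect, hψ.2.2, dotProduct_smul, smul_eq_mul,
    hubbardRingTV_groundEnergy_eq_energy]

/-- **`E₀/L = −4t·B + U·D` FOR A UNIT GROUND STATE** (real form): on the half-filled even ring
`L = 2n ≥ 4` (`t ≠ 0`, `U > 0`), for every unit ground state `ψ`, every site `p₀` and spin `σ₀`,
`E₀(2n; t, U; n, n) = 2n · (−4t·Re⟨c†_{p₀σ₀} c_{(p₀+1)σ₀}⟩_ψ + U·Re⟨n_{p₀↑} n_{p₀↓}⟩_ψ)`. [folklore] -/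
theorem hubbardRingTV_energy_eq_mul_site (hn : 2 ≤ n) (ht : t ≠ 0) (hU : 0 < U)
    (hψ : IsGroundState (hubbardRingTV (2 * n) t U).hamiltonian (2 * n) ψ) (hψ1 : star ψ ⬝ᵥ ψ = 1)
    (p₀ : Fin (2 * n)) (σ₀ : Fin 2) :
    Model.energy (hubbardRingTV (2 * n) t U) n n =
      (2 * n : ℕ) * (-4 * (t : ℝ) * (expect (creation (orb p₀ σ₀) * annihilation (orb (finRotate (2 * n) p₀) σ₀)) ψ).re +
        (U : ℝ) * (expect (numberOp p₀ 0 * numberOp p₀ 1) ψ).re) := by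
  have h := congrArg Complex.re (hubbardRingTV_energy_mul_norm_eq_mul_site hn ht hU hψ p₀ σ₀)
  rw [hψ1, mul_one, Complex.ofReal_re] at h
  rw [h, ← Complex.ofReal_ratCast, ← Complex.ofReal_ratCast]
  simp only [Complex.mul_re, Complex.add_re, Complex.neg_re, Complex.neg_im, Complex.ofReal_re,
    Complex.ofReal_im, Complex.natCast_re, Complex.natCast_im, Complex.re_ofNat, Complex.im_ofNat,
    Complex.mul_im, zero_mul, sub_zero, add_zero, mul_zero]
  ring

end GroundState

/-! ## §3 Consequences in the ground state: `B` is real, `U·D ≤ 4t·B`, and `t·B ≥ 0` -/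

section Consequences

variable {n : ℕ} {t U : ℚ} {ψ : Fock (Orb (Fin (2 * n)))}

/-- The double occupancy of a site is a non-negative expectation in EVERY vector:
`0 ≤ Re⟨n_{x↑} n_{x↓}⟩_ψ` (`n_{x↑} n_{x↓}` is the indicator of double occupancy). [folklore] -/
theorem re_expect_doubleOccupancy_nonneg {L : ℕ} (x : Fin L) (φ : Fock (Orb (Fin L))) :
    0 ≤ (expect (numberOp x 0 * numberOp x 1) φ).re := by
  rw [Literature.MathematicalPhysics.QuantumLattice.expect, dotProduct, Complex.re_sum]
  refine Finset.sum_nonneg fun s _ => ?_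
  rw [LiebTwo.numberOp_mul_numberOp_mulVec, Pi.star_apply]
  split_ifs
  · rw [Complex.star_def, Complex.mul_re, Complex.conj_re, Complex.conj_im]
    nlinarith [sq_nonneg (φ s).re, sq_nonneg (φ s).im]
  · simp

/-- **THE GROUND-STATE BOND AMPLITUDE IS REAL**: `Im⟨c†_{pσ} c_{(p+1)τ}⟩_ψ = 0` in every half-filled
ground state of the even ring (`t ≠ 0`, `U > 0`; the tree's Lieb–Loss–McCann reality lemma
`star_expect_creation_mul_annihilation_of_groundState`). [folklore] -/
theorem hubbardRingTV_groundState_oneBody_im (hn : 1 ≤ n) (ht : t ≠ 0) (hU : 0 < U)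
    (hψ : IsGroundState (hubbardRingTV (2 * n) t U).hamiltonian (2 * n) ψ) (a b : Orb (Fin (2 * n))) :
    (expect (creation a * annihilation b) ψ).im = 0 := by
  have hg := hubbardRingTV_isGroundState_graph hψ
  have h := star_expect_creation_mul_annihilation_of_groundState (ringGraph_connected (by omega : 0 < 2 * n))
    (evenSites (2 * n)) (evenSites_bipartite n) (card_compl_evenSites n)
    (by exact_mod_cast ht) (by exact_mod_cast hU) hg.1 hg.2.2 a b
  rw [Complex.star_def] at h
  exact Complex.conj_eq_iff_im.1 h

/-- **`U·D ≤ 4t·B` IN THE GROUND STATE.** On the half-filled even ring `L = 2n ≥ 4` (`t ≠ 0`, `U > 0`)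
every ground state `ψ` satisfies `U·Re⟨n_{p↑} n_{p↓}⟩_ψ ≤ 4t·Re⟨c†_{pσ} c_{(p+1)σ}⟩_ψ` at every site
and spin: `E₀ ≤ 0` (`hubbardRingTV_sectorGroundEnergy_le_zero`) read through the intensive identity —
the kinetic energy per site pays for the interaction energy per site. [folklore] -/
theorem hubbardRingTV_groundState_mul_doubleOccupancy_le (hn : 2 ≤ n) (ht : t ≠ 0) (hU : 0 < U)
    (hψ : IsGroundState (hubbardRingTV (2 * n) t U).hamiltonian (2 * n) ψ) (p : Fin (2 * n)) (σ : Fin 2) :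
    (U : ℝ) * (expect (numberOp p 0 * numberOp p 1) ψ).re ≤
      4 * (t : ℝ) * (expect (creation (orb p σ) * annihilation (orb (finRotate (2 * n) p) σ)) ψ).re := by
  -- normalise the ground state
  have hψ0 : ψ ≠ 0 := hψ.2.1
  have hpos : 0 < (star ψ ⬝ᵥ ψ).re := by
    have h1 : 0 < star ψ ⬝ᵥ ψ :=
      lt_of_le_of_ne (dotProduct_star_self_nonneg ψ) (Ne.symm (mt dotProduct_star_self_eq_zero.1 hψ0))
    exact (Complex.pos_iff.1 h1).1
  have hE0 : Model.energy (hubbardRingTV (2 * n) t U) n n ≤ 0 :=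
    StrongCouplingDoublon.hubbardRingTV_sectorGroundEnergy_le_zero t U (by ring : n + n = 2 * n)
  have h := congrArg Complex.re (hubbardRingTV_energy_mul_norm_eq_mul_site hn ht hU hψ p σ)
  have hnorm_im : (star ψ ⬝ᵥ ψ).im = 0 := by
    have h1 : 0 ≤ star ψ ⬝ᵥ ψ := dotProduct_star_self_nonneg ψ
    exact (Complex.nonneg_iff.1 h1).2.symm
  rw [Complex.mul_re, Complex.ofReal_re, Complex.ofReal_im, zero_mul, sub_zero, ← Complex.ofReal_ratCast,
    ← Complex.ofReal_ratCast] at h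
  simp only [Complex.mul_re, Complex.add_re, Complex.neg_re, Complex.neg_im, Complex.ofReal_re,
    Complex.ofReal_im, Complex.natCast_re, Complex.natCast_im, Complex.re_ofNat, Complex.im_ofNat,
    Complex.mul_im, zero_mul, sub_zero, add_zero, mul_zero] at h
  -- `E₀ · ‖ψ‖² ≤ 0` and `‖ψ‖² > 0`, `2n > 0`
  have hprod : Model.energy (hubbardRingTV (2 * n) t U) n n * (star ψ ⬝ᵥ ψ).re ≤ 0 :=
    mul_nonpos_of_nonpos_of_nonneg hE0 hpos.le
  rw [h] at hprod
  have hn' : (0 : ℝ) < (2 * n : ℕ) := by exact_mod_cast (by omega : 0 < 2 * n)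
  nlinarith

/-- **THE GROUND-STATE BOND AMPLITUDE IS NON-NEGATIVE FOR `t > 0`** (and `≤ 0` for `t < 0`): on the
half-filled even ring `L = 2n ≥ 4` with `U > 0`, `0 ≤ t·Re⟨c†_{pσ} c_{(p+1)σ}⟩_ψ` in every ground state
(`U·D ≥ 0` and the previous inequality). [folklore] -/
theorem hubbardRingTV_groundState_mul_bond_nonneg (hn : 2 ≤ n) (ht : t ≠ 0) (hU : 0 < U)
    (hψ : IsGroundState (hubbardRingTV (2 * n) t U).hamiltonian (2 * n) ψ) (p : Fin (2 * n)) (σ : Fin 2) :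
    0 ≤ (t : ℝ) * (expect (creation (orb p σ) * annihilation (orb (finRotate (2 * n) p) σ)) ψ).re := by
  have h := hubbardRingTV_groundState_mul_doubleOccupancy_le hn ht hU hψ p σ
  have hD := re_expect_doubleOccupancy_nonneg p ψ
  have hU' : (0 : ℝ) < U := by exact_mod_cast hU
  nlinarith [mul_nonneg hU'.le hD]

end Consequences

/-! ## §4 The bond amplitude is at most the free one: `8n·t·B ≤ −E₀(2n; t, 0; n, n)·‖ψ‖²` -/

section FreeBound

variable {n : ℕ} {t U : ℚ} {ψ : Fock (Orb (Fin (2 * n)))}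

/-- **The kinetic energy of the ground state**: for a ground state `ψ` of `hubbardRingTV (2n) t U`
(`n ≥ 2`, `t ≠ 0`, `U > 0`) the expectation of the FREE Hamiltonian `H(t, 0)` is
`⟨ψ, H(t,0) ψ⟩ = 2n · (−4t · ⟨c†_{p₀σ₀} c_{(p₀+1)σ₀}⟩_ψ)` for every site and spin. [folklore] -/
theorem hubbardRingTV_groundState_expect_free_eq_mul_site (hn : 2 ≤ n) (ht : t ≠ 0) (hU : 0 < U)
    (hψ : IsGroundState (hubbardRingTV (2 * n) t U).hamiltonian (2 * n) ψ) (p₀ : Fin (2 * n)) (σ₀ : Fin 2) :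
    expect (hubbardRingTV (2 * n) t 0).hamiltonian ψ =
      ((2 * n : ℕ) : ℂ) * (-(4 * (t : ℂ)) *
        expect (creation (orb p₀ σ₀) * annihilation (orb (finRotate (2 * n) p₀) σ₀)) ψ) := by
  have hn1 : 1 ≤ n := by omega
  rw [hubbardRingTV_expect_eq (by omega) t 0 ψ,
    Finset.sum_congr rfl fun x _ => Finset.sum_congr rfl fun σ _ => by
      rw [hubbardRingTV_groundState_bond_reverse hn1 ht hU hψ x σ,
        hubbardRingTV_groundState_bond_eq hn1 ht hU hψ x p₀ σ σ₀]]
  simp only [Finset.sum_const, Finset.card_univ, Fintype.card_fin, nsmul_eq_mul, Rat.cast_zero, zero_mul,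
    add_zero]
  push_cast
  ring

/-- **THE INTERACTING BOND AMPLITUDE IS AT MOST THE FREE ONE**:
`2n · 4t · Re⟨c†_{pσ} c_{(p+1)σ}⟩_ψ ≤ −E₀(2n; t, 0; n, n) · ‖ψ‖²` for every ground state `ψ` of
`hubbardRingTV (2n) t U` (`n ≥ 2`, `t ≠ 0`, `U > 0`): the ground state lies in the `(n, n)` sector (Lieb),
so its kinetic energy is at least the FREE sector ground energy times its norm (Rayleigh–Ritz for
`H(t, 0)`) — switching on `U` can only shrink the bond amplitude. [folklore] -/
theorem hubbardRingTV_groundState_mul_bond_le_free (hn : 2 ≤ n) (ht : t ≠ 0) (hU : 0 < U)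
    (hψ : IsGroundState (hubbardRingTV (2 * n) t U).hamiltonian (2 * n) ψ) (p : Fin (2 * n)) (σ : Fin 2) :
    (2 * n : ℕ) * (4 * (t : ℝ) * (expect (creation (orb p σ) * annihilation (orb (finRotate (2 * n) p) σ)) ψ).re) ≤
      -Model.energy (hubbardRingTV (2 * n) t 0) n n * (star ψ ⬝ᵥ ψ).re := by
  have hn1 : 1 ≤ n := by omega
  have hsec := hubbardRingTV_groundState_isInSector hn1 ht hU hψ
  have hpos : 0 < (star ψ ⬝ᵥ ψ).re := by
    have h1 : 0 < star ψ ⬝ᵥ ψ :=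
      lt_of_le_of_ne (dotProduct_star_self_nonneg ψ) (Ne.symm (mt dotProduct_star_self_eq_zero.1 hψ.2.1))
    exact (Complex.pos_iff.1 h1).1
  have h := congrArg Complex.re (hubbardRingTV_groundState_expect_free_eq_mul_site hn ht hU hψ p σ)
  rw [← Complex.ofReal_ratCast] at h
  simp only [Complex.mul_re, Complex.neg_re, Complex.neg_im, Complex.ofReal_re, Complex.ofReal_im,
    Complex.natCast_re, Complex.natCast_im, Complex.re_ofNat, Complex.im_ofNat, Complex.mul_im, zero_mul,
    sub_zero, add_zero, mul_zero] at h
  -- Rayleigh–Ritz in the `(n, n)` sector for the free Hamiltonian, with `u = ⟨ψ, H(t,0) ψ⟩ / ‖ψ‖²`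
  set K := (expect (hubbardRingTV (2 * n) t 0).hamiltonian ψ).re with hK
  have hRR : Model.energy (hubbardRingTV (2 * n) t 0) n n ≤ K / (star ψ ⬝ᵥ ψ).re := by
    refine sectorGroundEnergy_le_of_rayleigh (hubbardRingTV_hamiltonian_isHermitian (2 * n) t 0) hsec hψ.2.1 ?_
    rw [div_mul_cancel₀ _ hpos.ne']
    exact le_of_eq rfl
  have hRR' := (le_div_iff₀ hpos).1 hRR
  rw [h] at hRR'
  nlinarith

/-- Unit form: for a UNIT ground state, `2n · 4t · Re B ≤ −E₀(2n; t, 0; n, n)` and hence, with §3,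
`2n · U · Re D ≤ −E₀(2n; t, 0; n, n)` — the interaction energy is at most the free kinetic energy in
magnitude. [folklore] -/
theorem hubbardRingTV_groundState_mul_doubleOccupancy_le_free (hn : 2 ≤ n) (ht : t ≠ 0) (hU : 0 < U)
    (hψ : IsGroundState (hubbardRingTV (2 * n) t U).hamiltonian (2 * n) ψ) (hψ1 : star ψ ⬝ᵥ ψ = 1)
    (p : Fin (2 * n)) (σ : Fin 2) :
    (2 * n : ℕ) * (4 * (t : ℝ) * (expect (creation (orb p σ) * annihilation (orb (finRotate (2 * n) p) σ)) ψ).re) ≤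
        -Model.energy (hubbardRingTV (2 * n) t 0) n n ∧
      (2 * n : ℕ) * ((U : ℝ) * (expect (numberOp p 0 * numberOp p 1) ψ).re) ≤
        -Model.energy (hubbardRingTV (2 * n) t 0) n n := by
  have h1 := hubbardRingTV_groundState_mul_bond_le_free hn ht hU hψ p σ
  rw [hψ1, Complex.one_re, mul_one] at h1
  have h2 := hubbardRingTV_groundState_mul_doubleOccupancy_le hn ht hU hψ p σ
  have hn' : (0 : ℝ) < (2 * n : ℕ) := by exact_mod_cast (by omega : 0 < 2 * n)
  exact ⟨h1, by nlinarith⟩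

end FreeBound

end RingEnergy

end Summit.Ventures.CertifiedQuantumChemistry

end
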